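import Summits.Ventures.CertifiedManyBodySolver.Theses.M3PrimeEdgeSplit
import Summits.Ventures.CertifiedManyBodySolver.Theses.M3x2EdgeSplit
import Summits.Ventures.CertifiedManyBodySolver.Theorems.M3PrimeEdgeSplitLowerEdge_ge_m4o5SlackAbsorb
import Summits.Ventures.CertifiedManyBodySolver.Theorems.M3x2EdgeSplitLowerEdge_ge_m83o100SlackAbsorb
import Literature.MathematicalPhysics.QuantumLattice.HubbardNNNHoppingWindowCertificateD4
import Literature.Analysis.Convex.MatrixStarAlgebraPSD
import Literature.MathematicalPhysics.QuantumChemistry.T2ConditionTrace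
import Literature.MathematicalPhysics.QuantumManyBody.StateRelaxationFactored

/-!
# Line `clique-sparse-sos` (rev 3) — CLIQUE-SPARSE (chordal / correlative / term-sparse) SOS EDITIONS, and their
# FACTORED (PSD-free) replay normal form, for crux `LowerEdge_ge_m4o5` (stmt-Ventures-21721; shared with
# `LowerEdge_ge_m83o100`, stmt-Ventures-22024)

Team lb-chord (hub-lb, D-0154 (1) block (B)); crux-plan seat hub-lb-chord-plan-2 (rev 3: its gen-1 successor).
HONEST FRAMING: a certified bound is a number with a certificate; nothing here predicts
superconductivity; no summit statement and no bound is proved in this file (the two VALUE stubs are `sorry`);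
the certified floor of record stays #529 = −0.8295699476 (−4/5 needs +0.0296; −83/100 is met BY VALUE only,
un-landed in Lean).
REV 3 IN ONE PARAGRAPH (2026-08-28 ≈09:1xZ): (i) the Ward slot is now IMPORTED from the landed Theorems modules
(`…Theorems.WardSlot.{WardD4Identity, WardD4WindowSound, stub_wardWindowSound (p612283), WardSlackWindowBound,
stub_slackAbsorb (p613156)}`) — the rev-2 verbatim copies and the `stub_wardWindowSound` sorry are GONE, sorries 3 → 2,
and class-B soundness `m3Row_of_cliqueWardCertGe'` is UNCONDITIONAL; (ii) CLASS C `FactorWardCertGe q` = the FACTORED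
(Burer–Monteiro, «G = LLᵀ by construction») clique Ward certificate — the shape of every kernel-replayable object on the
shelf (LOWRANK-CERT K 32, SymCert gram rows) — with `factorWardCertGe_iff_clique`, `factorWardCertGe_iff_W4`,
`m3Row_of_factorWardCertGe`, `nearCertGe_of_factorWardCertGe` and `gramForm_factor_eq_sum_hermitianSq` all PROVED:
positivity is structural, so a class-C replay checks ONE free-algebra identity + an ℓ¹ sum and nothing spectral — this
is the TYPE of the cell's adopted L3/L6 rule «MATRIX-FORM GRAM is MANDATORY from v0′ upward: ship FACTOR ROWS per word,
form g_ij = ⟨L_i, L_j⟩ in the checker, PSD by construction (Gram of vectors), no test» (crit-1 V71 (B), STATUS l.1070,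
from sym-eng-1's exact v0′ count Σ_t s_t² = 5.27×10⁸ SOS word products vs 1.22×10⁶ listed pairs): `L k` = the factor
rows of block k, `(L k)ᴴ * L k` = the g_ij the checker forms, and `gramForm_factor_eq_sum_hermitianSq` is the proved
identity «matrix-form Gram element = SOS-column sum», so either expansion replays the same class-C literal;
(iii) the lb-chord VALUE line at MENU is DEAD (STATUS l.938: PART8S5 Δv +2.8e-2 = 28× the 1e-3 bar; R8 transfer
1.65e-2 FAIL-as-instrument l.912; class/arm covers DEAD l.920) — what survives of this line is the TYPE side: the
instance maps below are the home of the S1 «certificate SIZE via dual rank» lever for stmt-Ventures-22024 (SIZE BAR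
≤ ≈ 50 MB at loss ≤ 4e-4, pub INBOX), not a value claim for −4/5.

THE LEVER IN ONE SENTENCE. A translation-invariant moment/SOS relaxation whose Gram (moment) matrix is
required PSD only on a family of CLIQUES `K₁ … K_N` of the word set (lattice-local sub-frames, word
FAMILIES of an l1sym/MENU program, TSSOS sign/term blocks, running-intersection chains on a W5/W6 frame)
is again a relaxation — its SOS certificate is `H̃ − c = Σ_k gramForm Λ_k O_k + (null terms) + residual`
with every `Λ_k ⪰ 0` — and a SUM of Gram forms is ONE Gram form of the block-diagonal matrix
`blockDiagonal' Λ ⪰ 0` (`blockGram` + `MatrixStarAlgebra.posSemidef_blockDiagonal'_iff`), so the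
tree soundness theorem `ThermodynamicLimit.energyDensityTT'_ge_of_window_certificate_d4` applies verbatim:
SOUNDNESS OF THE SPARSE DUAL IS FREE. What sparsity buys is MEMORY/TIME (svec and nvar of the host
program), never value; the team question (director KEY 2026-08-28T03:04:59Z) is which clique family keeps
the certified value within 1e-3 of the dense program at ¼ memory, so that a (4,5)/(5,5)-footprint edition
the dense solvers cannot hold becomes certifiable. Lean cannot see memory: the edition stubs below are the
clique-form certificates the engines (hub-lb-chord-eng-*) must produce; its affordability is the content of
the line card `Lines/clique-sparse-sos.md` (falsifiers F0/F1 with crit-2's sealed bars).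

WHAT LEAN CAN AND CANNOT SEE. `cliqueCertBound_iff_windowCertBound` (proved below) records the honest
logical status: a clique-sparse certificate is exactly as strong as a dense one (one clique `ι = Unit` is the
dense case; `blockGram` is the converse) — sparsity adds MEMORY reach, not logical strength, so the ¼-memory /
Δv ≤ 3e-4 bars live in the falsifier protocol of the line card, not in a type. What the skeleton fixes is the
SHAPE of the object the engines must emit (per-clique PSD blocks `Λb k` over word lists `O k` in one algebra
`FermionOp Λ'`, shared eom/symmetry/charge null terms, one ℓ¹ residual) and its kernel-checked path to both
crux decls.

THREE CERTIFICATE CLASSES (A, B: rev 2, 2026-08-28 ≈06:3xZ, answering crit-1 §U (iii) «the skeleton quantifies over the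
Ward-free D₄ hypothesis list ⇒ needs wardk import or an su2avg stub»; C: rev 3, the factored replay normal form).
* CLASS A `CliqueCertBound q` — Ward-FREE clique-sparse D₄-window certificates (per-spin density multipliers,
  `S_z`-sector soundness): soundness `m3Row_of_cliqueCertBound` is PROVED UNCONDITIONALLY from the tree theorem
  `energyDensityTT'_ge_of_window_certificate_d4`; `cliqueCertBound_iff_windowCertBound` PROVED.
* CLASS B `CliqueWardCertGe q` — clique-sparse SU(2)-WARD × D₄ window certificates: the identity is
  `WardK.WardD4Identity` of the lb-sym line `wardk` (module `Lines.wardk_defs`, sorry-free, pen hub-lb-sym-plan-2)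
  with the Gram matrix `blockDiagonal' Λb`, one PSD block per clique, columns `O k : Fin (d k) → FermionOp Λ'` ARBITRARY
  algebra elements (so hw×D₄ column subsets, position/arm splits, arrow/star covers, GJSW un-specifications AND
  chord-eng-3's ROTATED-BASIS rank compression R8 `{U_kᵀ M_k(x) U_k ⪰ 0}` — `O k` := the columns of `V·U_k` — are all
  instances).  EVERY CERTIFICATE OF RECORD (CORE #294,
  MENU E₁ #529, the F3′a members) consumes Ward rows, so the editions that engines can actually produce live in
  class B; its soundness WAS the shared Ward debt `WardD4WindowSound` (wardk's W1 → W2 → W3) — LANDED since rev 2 as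
  `Theorems.WardSlot.stub_wardWindowSound` (p612283, hub-lb-sym-eng-3's Literature chain), imported here (rev 3).
  PROVED: `m3Row_of_cliqueWardCertGe : CliqueWardCertGe q → WardD4WindowSound → M3EnergyLowerRow 0 q` and its
  unconditional corollary `m3Row_of_cliqueWardCertGe'`
  (block PSD ⇒ `blockDiagonal'` PSD, `blockGram`), `gramForm_reindex`, and the honest identification
  `cliqueWardCertGe_iff : CliqueWardCertGe q ↔ WardK.WardD4CertGe q` (reindex `Σ k, Fin (d k) ≃ Fin N` one way,
  one block the other): COMPUTATIONALLY THERE IS ONE CRUX — a Ward × D₄ certificate of value ≥ q exists — read by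
  wardk as one dense Gram block and here with its clique structure exposed; what this line owns is the INSTANCE MAP
  (per-block PSD data `Λb k ⪰ 0` is what a sparse cert/0 carries and what a checker verifies block by block) and the
  memory question, which Lean cannot see (line card).
* CLASS C `FactorWardCertGe q` (rev 3, `section FactorClass`) — the SAME identity with every block shipped as a FACTOR
  `L k : Matrix (Fin (r k)) (Fin (d k)) ℂ` and Gram `blockDiagonal' (fun k => (L k)ᴴ * L k)`: positivity is
  `Matrix.posSemidef_conjTranspose_mul_self`, i.e. BY CONSTRUCTION; `gramForm_factor_eq_sum_hermitianSq` says the Gram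
  element is literally `Σ_ρ (Σ_i L ρ i • O i)⋆(Σ_i L ρ i • O i)`.  PROVED: `cliqueWardCertGe_of_factor`,
  `factor_of_cliqueWardCertGe` (square factors from `posSemidef_iff_exists_mem_conjTranspose_mul_self`),
  `factorWardCertGe_iff_clique`, `factorWardCertGe_iff_W4`, `m3Row_of_factorWardCertGe` (UNCONDITIONAL),
  `lowerEdge_*_of_factorEdition`, `nearCertGe_of_factorWardCertGe` (§B′).  This is the typed home of the objects the
  cell actually replays — LOWRANK-CERT «G = LLᵀ, K = 32» (pub lowrank-cert/SUMMARY.md), SymCert `gram` rows `(d_k, q_k)`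
  (hub-lb-sym-eng SYMCERT-FORMAT §2), chord-plan-1's «stub_psdCheck_sound OFF the data path» — and of lever S1
  (certificate SIZE = Σ_k r_k·d_k numbers, governed by the RANKS r_k, not by d_k²).
REGISTRY STATUS (captain ruling 2026-08-28 06:28:34Z «skeleton of record = status quo frozen» O1–O4, crit-1 g2 06:31:23Z;
crit-3 VERDICT-3 #14 freeze; HANDOFF §U6 08:42Z «registry unchanged»): the REGISTERED skeletons are
`Lines/fo_dual_rounding.lean` on BOTH items (dual-plan-2 pen; rev 4, sha16 eda0b6b580830f1b / 37410118d4a74e25, crit-1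
V71 (A) STATUS l.1070 08:52Z; stubs 1–2 LANDED p612283/p613156 and twins p612562/p613744; SOLE ACTIVE value stub each,
`stub_nearCert_m4o5 : NearCertWardSlack_m4o5` / `stub_nearCert_m83o100`); THIS FILE IS AN
UNREGISTERED, ELABORATING, CITEABLE CRUX WORKFILE (O3; it issues no `ledger skeleton check`, O4).  It needs no slot:
§B′ PROVES the instance maps `nearCertGe_of_cliqueWardCertGe : CliqueWardCertGe q → NearCertWardSlackGe q` (an exact
clique certificate is a near-certificate with δ = 0 and weights r² = tr(OᴴO)) and `nearCertGe_of_factorWardCertGe`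
(class C), and `nearCert_m4o5_of_cliqueWardEdition` / `nearCert_m83o100_of_cliqueWardEdition`, whose conclusions are the
registered stubs' statements (rfl-equal copies: `Cruxes/…/Lines/*.lean` are not importable modules) — an lb-chord /
lb-dual / lb-sym certificate in clique OR factored form discharges THE REGISTERED VALUE STUB through one lemma.
WARD TEXT (rev 3): `WardD4Identity` / `WardD4WindowSound` / `WardSlackWindowBound` and the proved `stub_wardWindowSound` /
`stub_slackAbsorb` are IMPORTED from `Theorems/M3PrimeEdgeSplitLowerEdge_ge_m4o5{WardWindowSound,SlackAbsorb}.lean`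
(namespace `…Theorems.WardSlot`); only wardk_defs' W4 VALUE texts `WardD4CertGe`, `WardD4Cert_m4o5`, `WardD4Cert_m83o100`
remain as copies in `namespace WardText` (wardk_defs is a Lines workfile, not importable); `wardWindowSound_textM83_eq`
checks by `rfl` that the −83/100 item's landed Ward text (`…Theorems.WardSlotM83`) is the same text.
STUBS (the only `sorry`s; names as a registration would record them): `stub_cliqueWardEdition_m4o5` (XL — THE EDITION,
class B, value ≥ −4/5; ⇔ wardk W4 `WardD4Cert_m4o5` by `cliqueWardEdition_m4o5_iff_W4`, PROVED; ⇔ a class-C factored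
edition by `factorWardCertGe_iff_clique`), `stub_cliqueWardEdition_m83o100` (L — FIRST RUNG, the stmt-Ventures-22024 bar;
⇔ `WardD4Cert_m83o100`; met BY VALUE by #529 and by LOWRANK-CERT K 32 (−0.829842043254, un-landed), Lean content = an
exact replay of a class-C literal inside the SIZE BAR).  rev 2's `stub_wardWindowSound` is DISCHARGED BY IMPORT (p612283);
rev 1's Ward-free stubs `stub_cliqueEdition_*` stay WITHDRAWN; class A keeps its proved hypothesis-form compositions
`lowerEdge_*_of_edition`, class C adds `lowerEdge_*_of_factorEdition` (sorry-free, unconditional).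
COMPOSITIONS (kernel-checked, conclude the cruxes BY NAME from ONE value stub each + the landed Ward theorem):
`LowerEdge_ge_m4o5_of` (stmt-Ventures-21721), `LowerEdge_ge_m83o100_of` (stmt-Ventures-22024).
TREE POINTERS (cite, do not re-prove; chord-idea-1 06:09:30Z): PSD completion on chordal patterns with the
running-intersection property = `Literature.Analysis.Matrix.ChordalCompletion.exists_posSemidef_completion_of_rip`,
`exists_posSemidef_glue` (Literature/Analysis/Matrix/ChordalPSDCompletion.lean); the dual (Agler) side =
`Literature.Analysis.Matrix.ChordalSparsityDecomposition`; block-diagonal PSD = `MatrixStarAlgebra.posSemidef_blockDiagonal'_iff`.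
-/

namespace Summit.Ventures.CertifiedManyBodySolver.Cruxes.LowerEdge_ge_m4o5.CliqueSparseSos

open Literature.MathematicalPhysics.QuantumLattice Literature.Probability.LatticeModels HubbardWave0
open Literature.MathematicalPhysics.QuantumLattice.ThermodynamicLimit
open Literature.MathematicalPhysics.QuantumManyBody.StateRelaxation
open scoped ComplexOrder BigOperators Matrix
/- rev 3 (the «rev 2.1 import swap», done against the LANDED modules): the ONE Ward text and its two proved stubs come
BY NAME from `Theorems/M3PrimeEdgeSplitLowerEdge_ge_m4o5{WardWindowSound,SlackAbsorb}.lean` (p612283 / p613156;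
namespace `…Theorems.WardSlot`; rfl-equal copies of the registered skeletons' §1 = wardk's text). No local copy of
`WardD4Identity` / `WardD4WindowSound` and no `stub_wardWindowSound` sorry remain in this file. -/
open Summit.Ventures.CertifiedManyBodySolver.Theorems.WardSlot
  (WardD4Identity WardD4WindowSound WardSlackWindowBound stub_wardWindowSound stub_slackAbsorb)

/-- DENSE window SOS certificate with bound `q` at the M3 point `(t, t′, U, n) = (1, 0, 8, 7/8)`: the exact
hypothesis list of `ThermodynamicLimit.energyDensityTT'_ge_of_window_certificate_d4` (one PSD Gram matrix
`Λm` over a finite word index type `m`, eom null terms `[H_{Λ'}, B_k]`, affine-`D₄` difference null terms,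
charge-violating words, anti-Hermitian parts, ℓ¹-penalised residual words) together with `q ≤ c − Σ‖a‖`. -/
def WindowCertBound (q : ℚ) : Prop :=
  ∃ (Λ Λ' : Finset (Site 2)) (hΛ : Λ ⊆ Λ') (_h8 : thicken Λ 1 ⊆ Λ')
    (h0 : thicken ({0} : Finset (Site 2)) 1 ⊆ Λ') (hz : (0 : Site 2) ∈ Λ')
    (μ : Fin 2 → ℝ)
    (m : Type) (_ : Fintype m) (_ : DecidableEq m) (Λm : Matrix m m ℂ) (_hΛm : Λm.PosSemidef)
    (O : m → FermionOp Λ')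
    (ns : ℕ) (B : Fin ns → FermionOp Λ)
    (nt : ℕ) (γ : Fin nt → DihedralGroup 4) (wv : Fin nt → Site 2)
    (hsh : ∀ l, d4ShiftSet (γ l) (wv l) Λ ⊆ Λ') (Y : Fin nt → FermionOp Λ)
    (nu : ℕ) (b : Fin nu → ℂ) (cw : Fin nu → List (Orb (PolySite Λ') × Bool))
    (_hcw : ∀ j, ladderCharge (cw j) ≠ 0 ∨ ladderSpinCharge (cw j) ≠ 0)
    (na : ℕ) (dc : Fin na → ℝ) (V : Fin na → FermionOp Λ')
    (nw : ℕ) (a : Fin nw → ℂ) (word : Fin nw → List (Orb (PolySite Λ') × Bool)) (c : ℝ),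
    (fermionEmbed (PolySite.incl h0) ((hubbardTTPrimeFermionInteraction 1 0 8).meanEnergyObs 1) -
        (c : ℂ) • (1 : FermionOp Λ') -
        ∑ σ : Fin 2, ((μ σ : ℝ) : ℂ) • (nAt 0 hz σ - (((7 / 8 : ℝ) / 2 : ℝ) : ℂ) • (1 : FermionOp Λ')) =
      gramForm Λm O +
        (∑ k, ((hubbardTTPrimeFermionInteraction 1 0 8).localHamiltonian Λ' *
              fermionEmbed (PolySite.incl hΛ) (B k) -
            fermionEmbed (PolySite.incl hΛ) (B k) * (hubbardTTPrimeFermionInteraction 1 0 8).localHamiltonian Λ') +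
          ∑ l, (fermionEmbed (PolySite.incl (hsh l)) (fermionEmbed (PolySite.d4Emb (γ l) (wv l) Λ) (Y l)) -
            fermionEmbed (PolySite.incl hΛ) (Y l)) +
          ∑ j, b j • ladderWord (cw j)) +
        (∑ m', ((dc m' : ℝ) : ℂ) • ((V m')ᴴ - V m') + ∑ k, a k • ladderWord (word k)))
    ∧ ((q : ℝ) ≤ c - ∑ k, ‖a k‖)

/-- CLIQUE-SPARSE window SOS certificate with bound `q` at the M3 point: the same identity with the single
Gram form replaced by a finite SUM of clique Gram forms `Σ_k gramForm (Λb k) (O k)`, one PSD block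
`Λb k ⪰ 0` per clique `k : ι` (clique = the words `O k : d k → FermionOp Λ'`; different cliques may share
words — overlap is allowed and is where running-intersection consistency lives, for free, because all
blocks are written in the SAME algebra `FermionOp Λ'` over the SAME moment functional). -/
def CliqueCertBound (q : ℚ) : Prop :=
  ∃ (Λ Λ' : Finset (Site 2)) (hΛ : Λ ⊆ Λ') (_h8 : thicken Λ 1 ⊆ Λ')
    (h0 : thicken ({0} : Finset (Site 2)) 1 ⊆ Λ') (hz : (0 : Site 2) ∈ Λ')
    (μ : Fin 2 → ℝ)
    (ι : Type) (_ : Fintype ι) (_ : DecidableEq ι)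
    (d : ι → Type) (_ : ∀ k, Fintype (d k)) (_ : ∀ k, DecidableEq (d k))
    (Λb : ∀ k, Matrix (d k) (d k) ℂ) (_hΛb : ∀ k, (Λb k).PosSemidef)
    (O : ∀ k, d k → FermionOp Λ')
    (ns : ℕ) (B : Fin ns → FermionOp Λ)
    (nt : ℕ) (γ : Fin nt → DihedralGroup 4) (wv : Fin nt → Site 2)
    (hsh : ∀ l, d4ShiftSet (γ l) (wv l) Λ ⊆ Λ') (Y : Fin nt → FermionOp Λ)
    (nu : ℕ) (b : Fin nu → ℂ) (cw : Fin nu → List (Orb (PolySite Λ') × Bool))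
    (_hcw : ∀ j, ladderCharge (cw j) ≠ 0 ∨ ladderSpinCharge (cw j) ≠ 0)
    (na : ℕ) (dc : Fin na → ℝ) (V : Fin na → FermionOp Λ')
    (nw : ℕ) (a : Fin nw → ℂ) (word : Fin nw → List (Orb (PolySite Λ') × Bool)) (c : ℝ),
    (fermionEmbed (PolySite.incl h0) ((hubbardTTPrimeFermionInteraction 1 0 8).meanEnergyObs 1) -
        (c : ℂ) • (1 : FermionOp Λ') -
        ∑ σ : Fin 2, ((μ σ : ℝ) : ℂ) • (nAt 0 hz σ - (((7 / 8 : ℝ) / 2 : ℝ) : ℂ) • (1 : FermionOp Λ')) =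
      (∑ k, gramForm (Λb k) (O k)) +
        (∑ k, ((hubbardTTPrimeFermionInteraction 1 0 8).localHamiltonian Λ' *
              fermionEmbed (PolySite.incl hΛ) (B k) -
            fermionEmbed (PolySite.incl hΛ) (B k) * (hubbardTTPrimeFermionInteraction 1 0 8).localHamiltonian Λ') +
          ∑ l, (fermionEmbed (PolySite.incl (hsh l)) (fermionEmbed (PolySite.d4Emb (γ l) (wv l) Λ) (Y l)) -
            fermionEmbed (PolySite.incl hΛ) (Y l)) +
          ∑ j, b j • ladderWord (cw j)) +
        (∑ m', ((dc m' : ℝ) : ℂ) • ((V m')ᴴ - V m') + ∑ k, a k • ladderWord (word k)))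
    ∧ ((q : ℝ) ≤ c - ∑ k, ‖a k‖)

/-! ## Soundness of clique-sparse data (proved): block-diagonal assembly -/

/-- A finite sum of clique Gram forms is the Gram form of the BLOCK-DIAGONAL matrix over the disjoint union
of the clique index types (pure `*`-algebra bookkeeping; with
`MatrixStarAlgebra.posSemidef_blockDiagonal'_iff` — a direct sum is PSD iff every block is — it is the whole
soundness content of sparsity: Agler–Helton–McCullough–Rodman's easy direction; chordality is needed only for
LOSSLESSNESS of the dense→sparse conversion (Grone–Johnson–Sá–Wolkowicz 1984), which Lean never has to see).
[cite: VandenbergheAndersen2015, §9–§10; Han2020Bootstrap, §2 eq. (3)] -/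
theorem blockGram {𝓐 : Type*} [Ring 𝓐] [StarRing 𝓐] [Algebra ℂ 𝓐]
    {ι : Type*} [Fintype ι] [DecidableEq ι] {d : ι → Type*} [∀ k, Fintype (d k)] [∀ k, DecidableEq (d k)]
    (Λb : ∀ k, Matrix (d k) (d k) ℂ) (O : ∀ k, d k → 𝓐) :
    gramForm (Matrix.blockDiagonal' Λb) (fun p : (Σ k, d k) => O p.1 p.2) = ∑ k, gramForm (Λb k) (O k) := by
  unfold gramForm
  rw [Fintype.sum_sigma]
  refine Finset.sum_congr rfl fun k _ => ?_
  refine Finset.sum_congr rfl fun i _ => ?_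
  rw [Fintype.sum_sigma]
  rw [Finset.sum_eq_single k]
  · refine Finset.sum_congr rfl fun j _ => ?_
    rw [Matrix.blockDiagonal'_apply_eq]
  · intro k' _ hk'
    apply Finset.sum_eq_zero
    intro j _
    rw [Matrix.blockDiagonal'_apply_ne _ _ _ (Ne.symm hk')]
    simp
  · intro h; exact absurd (Finset.mem_univ k) h

/-- Every clique-sparse certificate bound is a dense window certificate bound: index type `Σ k, d k`, Gram
matrix `blockDiagonal' Λb ⪰ 0`, Gram form rewritten by `blockGram`. -/
theorem windowCertBound_of_cliqueCertBound (q : ℚ) (hC : CliqueCertBound q) : WindowCertBound q := by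
  obtain ⟨Λ, Λ', hΛ, h8, h0, hz, μ, ι, instι, instιd, d, instd, instdd, Λb, hΛb, O, ns, B, nt, γ, wv, hsh, Y,
    nu, b, cw, hcw, na, dc, V, nw, a, word, c, hcert, hqc⟩ := hC
  refine ⟨Λ, Λ', hΛ, h8, h0, hz, μ, (Σ k, d k), inferInstance, inferInstance, Matrix.blockDiagonal' Λb, ?_,
    (fun p => O p.1 p.2), ns, B, nt, γ, wv, hsh, Y, nu, b, cw, hcw, na, dc, V, nw, a, word, c, ?_, hqc⟩
  · exact (Literature.Analysis.Convex.MatrixStarAlgebra.posSemidef_blockDiagonal'_iff Λb).2 hΛb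
  · rw [blockGram Λb O]
    exact hcert

/-- The dense certificate is the one-clique case (`ι = Unit`). Together with the previous lemma: the
clique-sparse edition is EXACTLY as strong as the dense edition — sparsity buys memory, not logic. -/
theorem cliqueCertBound_iff_windowCertBound (q : ℚ) : CliqueCertBound q ↔ WindowCertBound q := by
  refine ⟨windowCertBound_of_cliqueCertBound q, fun hW => ?_⟩
  obtain ⟨Λ, Λ', hΛ, h8, h0, hz, μ, m, instm, instmd, Λm, hΛm, O, ns, B, nt, γ, wv, hsh, Y,
    nu, b, cw, hcw, na, dc, V, nw, a, word, c, hcert, hqc⟩ := hW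
  refine ⟨Λ, Λ', hΛ, h8, h0, hz, μ, Unit, inferInstance, inferInstance, (fun _ => m), (fun _ => instm),
    (fun _ => instmd), (fun _ => Λm), (fun _ => hΛm), (fun _ => O), ns, B, nt, γ, wv, hsh, Y, nu, b, cw, hcw,
    na, dc, V, nw, a, word, c, ?_, hqc⟩
  simpa only [Finset.univ_unique, Finset.sum_singleton] using hcert

/-- A dense window SOS certificate at `(t, t′, U, n) = (1, 0, 8, 7/8)` with `q ≤ c − Σ‖a‖` gives the Venture
row `M3EnergyLowerRow 0 q`: the tree theorem `ThermodynamicLimit.energyDensityTT'_ge_of_window_certificate_d4`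
(`0 ≤ 8`, `0 ≤ 7/8 < 2`), every index Finset `univ`, then `le_trans` through the rational cast.
[cite: Han2020Bootstrap, §3] -/
theorem m3Row_of_windowCertBound (q : ℚ) (hW : WindowCertBound q) : M3EnergyLowerRow 0 q := by
  obtain ⟨Λ, Λ', hΛ, h8, h0, hz, μ, m, instm, instmd, Λm, hΛm, O, ns, B, nt, γ, wv, hsh, Y,
    nu, b, cw, hcw, na, dc, V, nw, a, word, c, hcert, hqc⟩ := hW
  have hmain := energyDensityTT'_ge_of_window_certificate_d4 1 0 (U := 8) (by norm_num) (n := 7 / 8)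
    (by norm_num) (by norm_num) hΛ h8 h0 hz μ hΛm O Finset.univ B Finset.univ γ wv hsh Y
    Finset.univ b cw (fun j _ => hcw j) Finset.univ dc V Finset.univ a word hcert
  unfold M3EnergyLowerRow
  exact le_trans (by exact_mod_cast hqc) hmain

/-- Clique-sparse certificate ⇒ Venture row (the two lemmas above). -/
theorem m3Row_of_cliqueCertBound (q : ℚ) (hC : CliqueCertBound q) : M3EnergyLowerRow 0 q :=
  m3Row_of_windowCertBound q (windowCertBound_of_cliqueCertBound q hC)

/-! ## CLASS B — clique-sparse SU(2)-Ward × D₄ certificates (the class every certificate of record lives in) -/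

/-! ### W4 value text — copies of lb-sym `Cruxes/LowerEdge_ge_m4o5/Lines/wardk_defs.lean` §W4 (pen hub-lb-sym-plan-2,
crux commit 220fd444c856; namespace there `…LowerEdge_ge_m4o5.WardK`), written over the IMPORTED Ward identity
`Theorems.WardSlot.WardD4Identity`.  Kept as copies ONLY because `Cruxes/…/Lines/*.lean` workfiles are not importable
modules (ONE-WARD-TEXT ruling, crit-3 VERDICT-3 #3 (C) / crit-1 05:40:45Z: verbatim copies are rfl-equal, not a second
Ward theorem).  rev 3: the identity `WardD4Identity` and the soundness statement `WardD4WindowSound` are NO LONGER copied —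
they are the landed constants of `Theorems/M3PrimeEdgeSplitLowerEdge_ge_m4o5WardWindowSound.lean` (p612283), opened above. -/
namespace WardText

open Matrix Finset

/-- **W4 (the computational crux, parametrised by the bound `q`) — a Ward × `D₄` window certificate of
value `≥ q` exists at `(t, t', U, n) = (1, 0, 8, 7/8)`**, all index sets finite ordinals (checker-friendly
normal form). -/
def WardD4CertGe (q : ℝ) : Prop :=
  ∃ (Λ Λ' : Finset (Site 2)) (hΛ : Λ ⊆ Λ') (_h8 : thicken Λ 1 ⊆ Λ')
    (h0 : thicken ({0} : Finset (Site 2)) 1 ⊆ Λ') (hz : (0 : Site 2) ∈ Λ')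
    (μ : ℝ)
    (nm : ℕ) (Λm : Matrix (Fin nm) (Fin nm) ℂ) (_hΛm : Λm.PosSemidef) (O : Fin nm → FermionOp Λ')
    (ns : ℕ) (B : Fin ns → FermionOp Λ)
    (nt : ℕ) (γ : Fin nt → DihedralGroup 4) (wv : Fin nt → Site 2)
    (hsh : ∀ l, d4ShiftSet (γ l) (wv l) Λ ⊆ Λ') (Y : Fin nt → FermionOp Λ)
    (nu : ℕ) (b : Fin nu → ℂ) (cw : Fin nu → List (Orb (PolySite Λ') × Bool))
    (_hcw : ∀ j ∈ (Finset.univ : Finset (Fin nu)), ladderCharge (cw j) ≠ 0 ∨ ladderSpinCharge (cw j) ≠ 0)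
    (np : ℕ) (Xp : Fin np → FermionOp Λ') (nm' : ℕ) (Xm : Fin nm' → FermionOp Λ')
    (na : ℕ) (dc : Fin na → ℝ) (V : Fin na → FermionOp Λ')
    (nw : ℕ) (a : Fin nw → ℂ) (word : Fin nw → List (Orb (PolySite Λ') × Bool))
    (c : ℝ),
    WardD4Identity 1 0 8 (7 / 8) hΛ h0 hz μ Λm O Finset.univ B Finset.univ γ wv hsh Y Finset.univ b cw
      Finset.univ Xp Finset.univ Xm Finset.univ dc V Finset.univ a word c ∧
    q ≤ c - ∑ k, ‖a k‖

/-- The two named instances used by the registered skeletons. -/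
def WardD4Cert_m4o5 : Prop := WardD4CertGe (-4 / 5)

/-- (twin, item stmt-Ventures-22024) -/
def WardD4Cert_m83o100 : Prop := WardD4CertGe (-83 / 100)

end WardText

section WardClass

open WardText

/-- CLASS B. A CLIQUE-SPARSE SU(2)-WARD × `D₄` WINDOW SOS CERTIFICATE with bound `q` at `(t,t′,U,n) = (1,0,8,7/8)`:
the identity `WardK.WardD4Identity` (energy − c − μ·(n₀ − n) = Gram + eom + affine-D₄ + charged words + the two
Ward families `Σ (S⁺X − XS⁺)`, `Σ (S⁻X′ − X′S⁻)` + anti-Hermitian parts + ℓ¹ residual) whose Gram matrix is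
`blockDiagonal' Λb` over `nb` cliques of sizes `d k`, block `k` PSD, columns `O k : Fin (d k) → FermionOp Λ′`
ARBITRARY algebra elements (so hw×D₄-adapted column subsets `V[:,C_k]`, position splits, arrow/star covers and
GJSW un-specifications are all instances), and `q ≤ c − Σ‖a‖`.  All index sets finite ordinals (checker normal
form).  By `blockGram` the Gram term is `Σ_k gramForm (Λb k) (O k)` = the engines' `Σ_k V_{C_k} S_k V_{C_k}ᵀ`. -/
def CliqueWardCertGe (q : ℚ) : Prop :=
  ∃ (Λ Λ' : Finset (Site 2)) (hΛ : Λ ⊆ Λ') (_h8 : thicken Λ 1 ⊆ Λ')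
    (h0 : thicken ({0} : Finset (Site 2)) 1 ⊆ Λ') (hz : (0 : Site 2) ∈ Λ')
    (μ : ℝ)
    (nb : ℕ) (d : Fin nb → ℕ) (Λb : ∀ k, Matrix (Fin (d k)) (Fin (d k)) ℂ) (_hΛb : ∀ k, (Λb k).PosSemidef)
    (O : ∀ k, Fin (d k) → FermionOp Λ')
    (ns : ℕ) (B : Fin ns → FermionOp Λ)
    (nt : ℕ) (γ : Fin nt → DihedralGroup 4) (wv : Fin nt → Site 2)
    (hsh : ∀ l, d4ShiftSet (γ l) (wv l) Λ ⊆ Λ') (Y : Fin nt → FermionOp Λ)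
    (nu : ℕ) (b : Fin nu → ℂ) (cw : Fin nu → List (Orb (PolySite Λ') × Bool))
    (_hcw : ∀ j, ladderCharge (cw j) ≠ 0 ∨ ladderSpinCharge (cw j) ≠ 0)
    (np : ℕ) (Xp : Fin np → FermionOp Λ') (nm' : ℕ) (Xm : Fin nm' → FermionOp Λ')
    (na : ℕ) (dc : Fin na → ℝ) (V : Fin na → FermionOp Λ')
    (nw : ℕ) (a : Fin nw → ℂ) (word : Fin nw → List (Orb (PolySite Λ') × Bool))
    (c : ℝ),
    WardD4Identity 1 0 8 (7 / 8) hΛ h0 hz μ (Matrix.blockDiagonal' Λb) (fun p : (Σ k, Fin (d k)) => O p.1 p.2)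
      Finset.univ B Finset.univ γ wv hsh Y Finset.univ b cw Finset.univ Xp Finset.univ Xm Finset.univ dc V
      Finset.univ a word c ∧
    ((q : ℝ) ≤ c - ∑ k, ‖a k‖)

/-- SOUNDNESS OF CLASS B modulo the shared Ward debt: a clique-sparse Ward × `D₄` certificate with bound `q`,
together with `WardK.WardD4WindowSound` (wardk's W3 target), gives the Venture row `M3EnergyLowerRow 0 q`.
Proof: the blocks are PSD ⇒ `blockDiagonal' Λb ⪰ 0` (`posSemidef_blockDiagonal'_iff`); apply the soundness
statement at index type `Σ k, Fin (d k)`; cast. -/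
theorem m3Row_of_cliqueWardCertGe (q : ℚ) (hC : CliqueWardCertGe q) (hS : WardD4WindowSound) :
    M3EnergyLowerRow 0 q := by
  obtain ⟨Λ, Λ', hΛ, h8, h0, hz, μ, nb, d, Λb, hΛb, O, ns, B, nt, γ, wv, hsh, Y, nu, b, cw, hcw,
    np, Xp, nm', Xm, na, dc, V, nw, a, word, c, hcert, hqc⟩ := hC
  have hpsd : (Matrix.blockDiagonal' Λb).PosSemidef :=
    (Literature.Analysis.Convex.MatrixStarAlgebra.posSemidef_blockDiagonal'_iff Λb).2 hΛb
  have hb := hS 1 0 8 (by norm_num) (7 / 8) (by norm_num) (by norm_num) Λ Λ' hΛ h8 h0 hz μ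
    (Σ k, Fin (d k)) inferInstance inferInstance (Matrix.blockDiagonal' Λb) hpsd (fun p => O p.1 p.2)
    (Fin ns) Finset.univ B (Fin nt) Finset.univ γ wv hsh Y (Fin nu) Finset.univ b cw (fun j _ => hcw j)
    (Fin np) Finset.univ Xp (Fin nm') Finset.univ Xm (Fin na) Finset.univ dc V (Fin nw) Finset.univ a word c hcert
  unfold M3EnergyLowerRow
  exact le_trans (by exact_mod_cast hqc) hb

/-- Gram forms are invariant under re-indexing the word list (used to put a clique family into wardk's
one-block `Fin N` normal form). -/
theorem gramForm_reindex {𝓐 : Type*} [Ring 𝓐] [StarRing 𝓐] [Algebra ℂ 𝓐]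
    {m m' : Type*} [Fintype m] [Fintype m'] (e : m ≃ m') (Λm : Matrix m m ℂ) (O : m → 𝓐) :
    gramForm (Matrix.reindex e e Λm) (O ∘ e.symm) = gramForm Λm O := by
  unfold gramForm
  simp only [Matrix.reindex_apply, Matrix.submatrix_apply, Function.comp_apply]
  rw [← e.symm.sum_comp]
  refine Finset.sum_congr rfl fun i _ => ?_
  rw [← e.symm.sum_comp]

/-- CLASS B IS wardk's W4 CLASS with the clique structure exposed (⇒: re-index `Σ k, Fin (d k) ≃ Fin N`,
`blockDiagonal' Λb ⪰ 0`; ⇐: one block).  Computationally there is ONE crux; this line owns the instance map. -/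
theorem cliqueWardCertGe_iff (q : ℚ) : CliqueWardCertGe q ↔ WardD4CertGe (q : ℝ) := by
  constructor
  · rintro ⟨Λ, Λ', hΛ, h8, h0, hz, μ, nb, d, Λb, hΛb, O, ns, B, nt, γ, wv, hsh, Y, nu, b, cw, hcw,
      np, Xp, nm', Xm, na, dc, V, nw, a, word, c, hcert, hqc⟩
    have hpsd : (Matrix.blockDiagonal' Λb).PosSemidef :=
      (Literature.Analysis.Convex.MatrixStarAlgebra.posSemidef_blockDiagonal'_iff Λb).2 hΛb
    let e : (Σ k, Fin (d k)) ≃ Fin (Fintype.card (Σ k, Fin (d k))) := Fintype.equivFin _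
    refine ⟨Λ, Λ', hΛ, h8, h0, hz, μ, Fintype.card (Σ k, Fin (d k)),
      Matrix.reindex e e (Matrix.blockDiagonal' Λb), ?_, (fun p : (Σ k, Fin (d k)) => O p.1 p.2) ∘ e.symm,
      ns, B, nt, γ, wv, hsh, Y, nu, b, cw, (fun j _ => hcw j), np, Xp, nm', Xm, na, dc, V, nw, a, word, c,
      ?_, hqc⟩
    · rw [Matrix.reindex_apply]
      exact hpsd.submatrix _
    · unfold WardD4Identity at hcert ⊢
      rw [gramForm_reindex]
      exact hcert
  · rintro ⟨Λ, Λ', hΛ, h8, h0, hz, μ, nm, Λm, hΛm, O, ns, B, nt, γ, wv, hsh, Y, nu, b, cw, hcw,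
      np, Xp, nm', Xm, na, dc, V, nw, a, word, c, hcert, hqc⟩
    refine ⟨Λ, Λ', hΛ, h8, h0, hz, μ, 1, (fun _ => nm), (fun _ => Λm), (fun _ => hΛm), (fun _ => O),
      ns, B, nt, γ, wv, hsh, Y, nu, b, cw, (fun j => hcw j (Finset.mem_univ j)), np, Xp, nm', Xm, na, dc, V,
      nw, a, word, c, ?_, hqc⟩
    have hone : gramForm (Matrix.blockDiagonal' (fun _ : Fin 1 => Λm))
        (fun p : (Σ _ : Fin 1, Fin nm) => (fun _ : Fin 1 => O) p.1 p.2) = gramForm Λm O := by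
      rw [blockGram (fun _ : Fin 1 => Λm) (fun _ : Fin 1 => O)]
      simp
    unfold WardD4Identity at hcert ⊢
    rw [hone]
    exact hcert

/-- `WardD4CertGe` is antitone in the bound. -/
theorem wardD4CertGe_mono {q q' : ℝ} (hle : q' ≤ q) (h : WardD4CertGe q) : WardD4CertGe q' := by
  obtain ⟨Λ, Λ', hΛ, h8, h0, hz, μ, nm, Λm, hΛm, O, ns, B, nt, γ, wv, hsh, Y, nu, b, cw, hcw,
    np, Xp, nm', Xm, na, dc, V, nw, a, word, c, hcert, hqc⟩ := h
  exact ⟨Λ, Λ', hΛ, h8, h0, hz, μ, nm, Λm, hΛm, O, ns, B, nt, γ, wv, hsh, Y, nu, b, cw, hcw,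
    np, Xp, nm', Xm, na, dc, V, nw, a, word, c, hcert, le_trans hle hqc⟩

/-- The −4/5 clique edition (class B) is EXACTLY wardk's computational crux W4 `WardD4Cert_m4o5`. -/
theorem cliqueWardEdition_m4o5_iff_W4 :
    (∃ q : ℚ, (-4 / 5 : ℚ) ≤ q ∧ CliqueWardCertGe q) ↔ WardD4Cert_m4o5 := by
  unfold WardD4Cert_m4o5
  constructor
  · rintro ⟨q, hq, hC⟩
    exact wardD4CertGe_mono (by exact_mod_cast hq) ((cliqueWardCertGe_iff q).1 hC)
  · intro h
    refine ⟨-4 / 5, le_rfl, (cliqueWardCertGe_iff (-4 / 5)).2 ?_⟩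
    simpa using h

/-- The −83/100 clique edition (class B) is EXACTLY wardk's `WardD4Cert_m83o100`. -/
theorem cliqueWardEdition_m83o100_iff_W4 :
    (∃ q : ℚ, (-83 / 100 : ℚ) ≤ q ∧ CliqueWardCertGe q) ↔ WardD4Cert_m83o100 := by
  unfold WardD4Cert_m83o100
  constructor
  · rintro ⟨q, hq, hC⟩
    exact wardD4CertGe_mono (by exact_mod_cast hq) ((cliqueWardCertGe_iff q).1 hC)
  · intro h
    refine ⟨-83 / 100, le_rfl, (cliqueWardCertGe_iff (-83 / 100)).2 ?_⟩
    simpa using h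

/-! ## Value stubs (the only `sorry`s of this file; UNREGISTERED workfile — names as a registration would record them) -/

/-- STUB 1 (XL — THE EDITION; hub-lb-chord-eng-* covers → FO/IPM → exact recert `G_b = Σ_k V_{C_k} S_k V_{C_k}ᵀ`
→ referee replay; closable only by a certified file): some CLIQUE-SPARSE SU(2)-Ward × `D₄` window SOS certificate
at `(U, n, t′) = (8, 7/8, 0)` has `c − Σ‖a‖ ≥ −4/5`.  ⇔ wardk W4 `WardD4Cert_m4o5` (`cliqueWardEdition_m4o5_iff_W4`):
ONE computational crux, read here with its clique structure exposed.  Why it might fail: no dated certified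
object sits on a CAP-admissible footprint for −4/5 (record #529 = −0.8295699476 on a (≤4,4)-cored host, gap
+0.0296; CAP(4,4) = −0.8004 < −4/5 so every cover must keep an extent-5 direction); every clique split of a
translation-invariant frame Gram block is a genuine relaxation (Toeplitz variable sharing: no a-priori lossless
split short of symmetry sectors), its loss must be MEASURED (crit-2 F1 bars Δv ≤ 3e-4 USEFUL / > 1e-3 DEAD at
≤ ¼ of the binding resource), and a lossless ÷4 of memory is worth only +0.005…0.010 of affordable null
(crit-1 P1) — so the edition must sit on a bigger host ((≤3,5)/(4,5)/(5,5)) whose own dense value clears −0.80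
with margin ≥ Δv + gap + rounding. -/
theorem stub_cliqueWardEdition_m4o5 : ∃ q : ℚ, (-4 / 5 : ℚ) ≤ q ∧ CliqueWardCertGe q := by
  sorry

/-- STUB 2 (L — FIRST RUNG, the stmt-Ventures-22024 bar for the same object): some clique-sparse Ward × `D₄`
window SOS certificate has `c − Σ‖a‖ ≥ −83/100`.  ⇔ wardk `WardD4Cert_m83o100`.  Met BY VALUE by MENU E₁ #529
= −0.8295699476 (an FO dual certificate over the Ward-reduced TL-moment program; margin to −0.83 = 4.3e-4).
A column-sparse replay of that program clears −0.83 iff `Δv_solve + gap_sparse + rounding ≤ 4.3e-4` (#529 of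
record: pobj→cert 6.9e-4 incl. rounding 1.66e-5) ⇒ a JOINT product of a cover (Δv, chord F1) and a tighter
first-order solve / finisher (gap; lb-dual) or an IPM-able f-lane program — never column-chord alone (crit-3
VERDICT-3 #2 correction, adopted).  Why it might fail: F1 loss above the margin for every affordable cover; no
finisher below 4.3e-4 − Δv; or the exact recert of a first-order iterate does not close (kept-row residual
1.9e-4 / PSD floor −4e-4 of x*(E₁) must be absorbed by the ℓ¹ residual). -/
theorem stub_cliqueWardEdition_m83o100 : ∃ q : ℚ, (-83 / 100 : ℚ) ≤ q ∧ CliqueWardCertGe q := by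
  sorry

/-- (rev 3) The former STUB 3 `stub_wardWindowSound : WardD4WindowSound` — the shared Ward debt — is LANDED:
`Theorems.WardSlot.stub_wardWindowSound` (p612283, proof term `energyDensityTT'_ge_of_wardD4_window_certificate`,
Literature chain W1 `HubbardTorusGenericSectorCertificate` → W2 `HubbardNNNHoppingWindowCertificateWardD4` → W3
`HubbardTTPrimeTorusFamilyTransport` / `…WardD4TL`, hub-lb-sym-eng-3).  It is used below BY NAME; this theorem records
that class-B soundness is therefore UNCONDITIONAL now. [cite: Han2020Bootstrap, §3] -/
theorem m3Row_of_cliqueWardCertGe' (q : ℚ) (hC : CliqueWardCertGe q) : M3EnergyLowerRow 0 q :=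
  m3Row_of_cliqueWardCertGe q hC stub_wardWindowSound

/-- Rung order (proved): the edition implies the first rung. -/
theorem cliqueWardEdition_m83o100_of_m4o5 (h : ∃ q : ℚ, (-4 / 5 : ℚ) ≤ q ∧ CliqueWardCertGe q) :
    ∃ q : ℚ, (-83 / 100 : ℚ) ≤ q ∧ CliqueWardCertGe q := by
  obtain ⟨q, hq, hC⟩ := h
  exact ⟨q, le_trans (by norm_num) hq, hC⟩

/-! ## Compositions -/

/-- Hypothesis form (sorry-free), class B: an edition at −4/5 plus Ward soundness gives the crux's statement. -/
theorem lowerEdge_m4o5_of_wardEdition (hed : ∃ q : ℚ, (-4 / 5 : ℚ) ≤ q ∧ CliqueWardCertGe q)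
    (hS : WardD4WindowSound) : ∃ lo : ℚ, (-4 / 5 : ℚ) ≤ lo ∧ M3EnergyLowerRow 0 lo := by
  obtain ⟨q, hq, hC⟩ := hed
  exact ⟨q, hq, m3Row_of_cliqueWardCertGe q hC hS⟩

/-- Hypothesis form (sorry-free), class B, sibling crux. -/
theorem lowerEdge_m83o100_of_wardEdition (hed : ∃ q : ℚ, (-83 / 100 : ℚ) ≤ q ∧ CliqueWardCertGe q)
    (hS : WardD4WindowSound) : ∃ lo : ℚ, (-83 / 100 : ℚ) ≤ lo ∧ M3EnergyLowerRow 0 lo := by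
  obtain ⟨q, hq, hC⟩ := hed
  exact ⟨q, hq, m3Row_of_cliqueWardCertGe q hC hS⟩

end WardClass

/-! ## CLASS C — FACTORED («PSD-free», Burer–Monteiro) clique Ward × D₄ certificates: the fork-of-record data path

Every certificate object the cell can actually replay in the kernel carries its Gram data as FACTORS, not as PSD
matrices: dual-eng-2's LOWRANK-CERT («G = L Lᵀ by construction»; K 32 j302676: per-component factors of total rank
4 894, value −3826970948379419601/2⁶² = −0.829842043254, margin 1.58e-4 over −83/100, crit-1 L5-B PASS-provisional),
lb-sym's `SymReplay.SymCert` (`gram : (d_k, q_k)` rows = an SOS `Σ_k d_k q_k† q_k`, `symCheck` = well-formedness + ONE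
free-algebra identity, no eigenvalue anywhere), chord-plan-1's census sentence «`stub_psdCheck_sound` TRUE but OFF the
data path».  CLASS C types that object inside the one Ward text: block `k` ships a factor
`L k : Matrix (Fin (r k)) (Fin (d k)) ℂ` (rank `r k`, any shape) over its word list `O k`, and the Gram matrix entered
into `WardD4Identity` is `blockDiagonal' (fun k => (L k)ᴴ * L k)` — positive semidefinite BY CONSTRUCTION
(`Matrix.posSemidef_conjTranspose_mul_self`), so a kernel replay of a class-C literal verifies a polynomial identity
and an ℓ¹ sum and NOTHING spectral (no Cholesky / LDLᵀ / λ_min enclosure inside Lean; cf. the Literature reader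
`StateRelaxation.le_re_map_of_blockFactoredCertificate_residual`, [BurerMonteiro2003, §1 eq. (2)]).  SIZE = Σ_k r_k·d_k
scalars + the word table (the S1 «certificate-size via dual rank» lever of the lb-chord close-out, l.938/945/947):
this is the quantity the 22024 SIZE BAR (≤ ≈ 50 MB at loss ≤ 4e-4, pub INBOX) constrains — Lean cannot see bytes,
but it can fix the SHAPE whose byte count is being barred, and that is this definition.
LOGICAL STATUS (proved below, honest): `factorWardCertGe_iff_clique : FactorWardCertGe q ↔ CliqueWardCertGe q`
(⇒ structural; ⇐ every PSD block is `Bᴴ B` inside the full matrix `*`-algebra, [BGSV Prop. 2.3] =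
`MatrixStarAlgebra.posSemidef_iff_exists_mem_conjTranspose_mul_self` at `𝒜 = ⊤`), hence `↔ WardD4CertGe q` (W4):
still ONE computational crux; class C is the REPLAY NORMAL FORM of it, class B the solver normal form, W4 the dense one.
`gramForm_factor_eq_sum_hermitianSq` records what a replay actually multiplies out:
`gramForm ((L)ᴴ L) O = Σ_ρ (Σ_i L_ρi • O_i)† (Σ_i L_ρi • O_i)`. -/

section FactorClass

open WardText

/-- What a class-C replay multiplies out: the Gram element of a FACTORED multiplier `Lᴴ L` is the plain sum of
hermitian squares of the «root polynomials» `q_ρ = Σ_i L_ρi • O_i` (one per factor row `ρ`; `L` of any shape).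
[cite: BurerMonteiro2003, §1 eq. (2) (p. 330); Han2020Bootstrap, §2 eq. (3)] -/
theorem gramForm_factor_eq_sum_hermitianSq {𝓐 : Type*} [Ring 𝓐] [StarRing 𝓐] [Algebra ℂ 𝓐] [StarModule ℂ 𝓐]
    {m k : Type*} [Fintype m] [Fintype k] (L : Matrix k m ℂ) (O : m → 𝓐) :
    gramForm (Lᴴ * L) O = ∑ ρ, star (∑ i, L ρ i • O i) * (∑ i, L ρ i • O i) := by
  have h : ∀ ρ : k, star (∑ i, L ρ i • O i) * (∑ j, L ρ j • O j) =
      ∑ i, ∑ j, (star (L ρ i) * L ρ j) • (star (O i) * O j) := by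
    intro ρ
    rw [star_lincomb, Finset.sum_mul]
    refine Finset.sum_congr rfl fun i _ => ?_
    rw [Finset.mul_sum]
    refine Finset.sum_congr rfl fun j _ => ?_
    rw [smul_mul_smul_comm]
  calc gramForm (Lᴴ * L) O
      = ∑ i, ∑ j, ∑ ρ, (star (L ρ i) * L ρ j) • (star (O i) * O j) := by
        unfold gramForm
        refine Finset.sum_congr rfl fun i _ => Finset.sum_congr rfl fun j _ => ?_
        rw [← Finset.sum_smul]
        congr 1 -- `(Lᴴ * L) i j = Σ_ρ star (L ρ i) * L ρ j` closes by `rfl` (`mul_apply`, `conjTranspose_apply`)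
    _ = ∑ i, ∑ ρ, ∑ j, (star (L ρ i) * L ρ j) • (star (O i) * O j) :=
        Finset.sum_congr rfl fun i _ => Finset.sum_comm
    _ = ∑ ρ, ∑ i, ∑ j, (star (L ρ i) * L ρ j) • (star (O i) * O j) := Finset.sum_comm
    _ = ∑ ρ, star (∑ i, L ρ i • O i) * (∑ i, L ρ i • O i) :=
        Finset.sum_congr rfl fun ρ _ => (h ρ).symm

/-- [BGSV Prop. 2.3] in the full matrix algebra: a PSD matrix is `Bᴴ B` for a square `B` (its PSD square root, a
polynomial in it).  The converse direction of class C ↔ class B. [cite: BachocEtAl2011, §2.3 Prop. 2.3] -/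
theorem exists_conjTranspose_mul_self_of_posSemidef {n : Type*} [Fintype n] [DecidableEq n]
    {A : Matrix n n ℂ} (hA : A.PosSemidef) : ∃ B : Matrix n n ℂ, Bᴴ * B = A := by
  obtain ⟨B, -, hB⟩ :=
    (Literature.Analysis.Convex.MatrixStarAlgebra.posSemidef_iff_exists_mem_conjTranspose_mul_self
      (⊤ : StarSubalgebra ℂ (Matrix n n ℂ)) (StarSubalgebra.mem_top (x := A))).1 hA
  exact ⟨B, hB⟩

/-- CLASS C. A FACTORED CLIQUE-SPARSE SU(2)-WARD × `D₄` WINDOW SOS CERTIFICATE with bound `q` at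
`(t,t′,U,n) = (1,0,8,7/8)`: the one Ward identity `WardD4Identity` with Gram matrix
`blockDiagonal' (fun k => (L k)ᴴ * L k)` — block `k` = a FACTOR `L k : Matrix (Fin (r k)) (Fin (d k)) ℂ` of any rank
`r k` over its word list `O k : Fin (d k) → FermionOp Λ′` (ARBITRARY algebra elements: raw words, hw×D₄-adapted
integer combinations `V·Ũ`, rotated bases are all instances) — NO positive-semidefiniteness field at all (it is
structural), the shared eom / affine-D₄ / charged-word / `S^±`-Ward / anti-Hermitian null data, an ℓ¹ residual, and
`q ≤ c − Σ‖a‖`.  All index sets finite ordinals (checker normal form).  This is the type of LOWRANK-CERT literals and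
of what `SymCert.gram` rows denote. [cite: BurerMonteiro2003, §1 eq. (2) (p. 330); Han2020Bootstrap, §3] -/
def FactorWardCertGe (q : ℚ) : Prop :=
  ∃ (Λ Λ' : Finset (Site 2)) (hΛ : Λ ⊆ Λ') (_h8 : thicken Λ 1 ⊆ Λ')
    (h0 : thicken ({0} : Finset (Site 2)) 1 ⊆ Λ') (hz : (0 : Site 2) ∈ Λ')
    (μ : ℝ)
    (nb : ℕ) (d : Fin nb → ℕ) (r : Fin nb → ℕ) (L : ∀ k, Matrix (Fin (r k)) (Fin (d k)) ℂ)
    (O : ∀ k, Fin (d k) → FermionOp Λ')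
    (ns : ℕ) (B : Fin ns → FermionOp Λ)
    (nt : ℕ) (γ : Fin nt → DihedralGroup 4) (wv : Fin nt → Site 2)
    (hsh : ∀ l, d4ShiftSet (γ l) (wv l) Λ ⊆ Λ') (Y : Fin nt → FermionOp Λ)
    (nu : ℕ) (b : Fin nu → ℂ) (cw : Fin nu → List (Orb (PolySite Λ') × Bool))
    (_hcw : ∀ j, ladderCharge (cw j) ≠ 0 ∨ ladderSpinCharge (cw j) ≠ 0)
    (np : ℕ) (Xp : Fin np → FermionOp Λ') (nm' : ℕ) (Xm : Fin nm' → FermionOp Λ')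
    (na : ℕ) (dc : Fin na → ℝ) (V : Fin na → FermionOp Λ')
    (nw : ℕ) (a : Fin nw → ℂ) (word : Fin nw → List (Orb (PolySite Λ') × Bool))
    (c : ℝ),
    WardD4Identity 1 0 8 (7 / 8) hΛ h0 hz μ (Matrix.blockDiagonal' fun k => (L k)ᴴ * L k)
      (fun p : (Σ k, Fin (d k)) => O p.1 p.2)
      Finset.univ B Finset.univ γ wv hsh Y Finset.univ b cw Finset.univ Xp Finset.univ Xm Finset.univ dc V
      Finset.univ a word c ∧
    ((q : ℝ) ≤ c - ∑ k, ‖a k‖)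

/-- Class C ⇒ class B: the blocks `(L k)ᴴ L k` are PSD BY CONSTRUCTION — no spectral test anywhere. -/
theorem cliqueWardCertGe_of_factor (q : ℚ) (hF : FactorWardCertGe q) : CliqueWardCertGe q := by
  obtain ⟨Λ, Λ', hΛ, h8, h0, hz, μ, nb, d, r, L, O, ns, B, nt, γ, wv, hsh, Y, nu, b, cw, hcw,
    np, Xp, nm', Xm, na, dc, V, nw, a, word, c, hcert, hqc⟩ := hF
  exact ⟨Λ, Λ', hΛ, h8, h0, hz, μ, nb, d, fun k => (L k)ᴴ * L k,
    fun k => Matrix.posSemidef_conjTranspose_mul_self (L k), O, ns, B, nt, γ, wv, hsh, Y, nu, b, cw, hcw,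
    np, Xp, nm', Xm, na, dc, V, nw, a, word, c, hcert, hqc⟩

/-- Class B ⇒ class C: factor every PSD block, `Λb k = (L k)ᴴ L k` with a SQUARE factor (`r k = d k`, the PSD
square root; exact rational/LDLᵀ factors are what engines ship, Lean only needs existence). -/
theorem factor_of_cliqueWardCertGe (q : ℚ) (hC : CliqueWardCertGe q) : FactorWardCertGe q := by
  obtain ⟨Λ, Λ', hΛ, h8, h0, hz, μ, nb, d, Λb, hΛb, O, ns, B, nt, γ, wv, hsh, Y, nu, b, cw, hcw,
    np, Xp, nm', Xm, na, dc, V, nw, a, word, c, hcert, hqc⟩ := hC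
  choose L hL using fun k => exists_conjTranspose_mul_self_of_posSemidef (hΛb k)
  refine ⟨Λ, Λ', hΛ, h8, h0, hz, μ, nb, d, d, L, O, ns, B, nt, γ, wv, hsh, Y, nu, b, cw, hcw,
    np, Xp, nm', Xm, na, dc, V, nw, a, word, c, ?_, hqc⟩
  have hfun : (fun k => (L k)ᴴ * L k) = Λb := funext hL
  rw [hfun]
  exact hcert

/-- CLASS C IS CLASS B with the positivity made structural (honest identification: ONE computational crux). -/
theorem factorWardCertGe_iff_clique (q : ℚ) : FactorWardCertGe q ↔ CliqueWardCertGe q :=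
  ⟨cliqueWardCertGe_of_factor q, factor_of_cliqueWardCertGe q⟩

/-- … and hence IS wardk's dense W4 class `WardD4CertGe q`. -/
theorem factorWardCertGe_iff_W4 (q : ℚ) : FactorWardCertGe q ↔ WardD4CertGe (q : ℝ) :=
  (factorWardCertGe_iff_clique q).trans (cliqueWardCertGe_iff q)

/-- SOUNDNESS OF CLASS C, UNCONDITIONAL (Ward slot landed): a factored clique Ward × `D₄` certificate with bound
`q` gives the Venture row `M3EnergyLowerRow 0 q`. -/
theorem m3Row_of_factorWardCertGe (q : ℚ) (hF : FactorWardCertGe q) : M3EnergyLowerRow 0 q :=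
  m3Row_of_cliqueWardCertGe q (cliqueWardCertGe_of_factor q hF) stub_wardWindowSound

/-- A factored edition at value `≥ −83/100` (resp. `≥ −4/5`) is exactly the value stub of this file. -/
theorem cliqueWardEdition_of_factorEdition {q₀ : ℚ} (h : ∃ q : ℚ, q₀ ≤ q ∧ FactorWardCertGe q) :
    ∃ q : ℚ, q₀ ≤ q ∧ CliqueWardCertGe q := by
  obtain ⟨q, hq, hF⟩ := h
  exact ⟨q, hq, cliqueWardCertGe_of_factor q hF⟩

/-- Hypothesis form (sorry-free, UNCONDITIONAL), class C: a factored edition at −83/100 gives the statement of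
crux `M3x2EdgeSplit.LowerEdge_ge_m83o100` (stmt-Ventures-22024) — the theorem a LOWRANK/SymCert-shaped literal plus an
identity replay instantiates, with no positive-semidefiniteness check anywhere in the kernel. -/
theorem lowerEdge_m83o100_of_factorEdition (hed : ∃ q : ℚ, (-83 / 100 : ℚ) ≤ q ∧ FactorWardCertGe q) :
    ∃ lo : ℚ, (-83 / 100 : ℚ) ≤ lo ∧ M3EnergyLowerRow 0 lo := by
  obtain ⟨q, hq, hF⟩ := hed
  exact ⟨q, hq, m3Row_of_factorWardCertGe q hF⟩

/-- Hypothesis form (sorry-free, UNCONDITIONAL), class C, the −4/5 crux `M3PrimeEdgeSplit.LowerEdge_ge_m4o5`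
(stmt-Ventures-21721; no certificate of value ≥ −4/5 exists today — record #529 = −0.8295699476). -/
theorem lowerEdge_m4o5_of_factorEdition (hed : ∃ q : ℚ, (-4 / 5 : ℚ) ≤ q ∧ FactorWardCertGe q) :
    ∃ lo : ℚ, (-4 / 5 : ℚ) ≤ lo ∧ M3EnergyLowerRow 0 lo := by
  obtain ⟨q, hq, hF⟩ := hed
  exact ⟨q, hq, m3Row_of_factorWardCertGe q hF⟩

/-- ONE WARD TEXT, checked: the −83/100 item's landed copy `Theorems.WardSlotM83.WardD4WindowSound` (p612562) is
rfl-equal to the −4/5 item's `Theorems.WardSlot.WardD4WindowSound` (p612283) used throughout this file. -/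
theorem wardWindowSound_textM83_eq :
    Summit.Ventures.CertifiedManyBodySolver.Theorems.WardSlotM83.WardD4WindowSound = WardD4WindowSound := rfl

end FactorClass

/-! ## §B′ INSTANCE MAP INTO THE SKELETON OF RECORD (captain ruling 2026-08-28 06:28:34Z, crit-1 g2 06:31:23Z:
stmt-Ventures-21721 ← `Lines/fo_dual_rounding.lean` (dual-plan-2, sha 94f99bf03038), stmt-Ventures-22024 ← its twin
(sha 74e9a7f66a0c); every other Lines file — this one included — is an UNREGISTERED citeable workfile).
The registered VALUE stubs are `FoDualRounding.stub_nearCert_m4o5 : NearCertWardSlack_m4o5` / `stub_nearCert_m83o100`: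
a PER-BLOCK near-certificate (blocks `Z k`, PSD floors `δ_k ≥ 0`, generator norm weights `r k i` with SOS proofs
`r² • 1 − OᴴO ⪰ 0`, value `q ≤ c − Σ‖a‖ − Σ_k δ_k Σ_i r²`). It is ALREADY clique-shaped. Below: its text, parametrised
in the value `q` and written over the one IMPORTED Ward text (`NearCertWardSlackGe (-4/5)` is
`FoDualRounding.NearCertWardSlack_m4o5` VERBATIM up to that skeleton's own rfl-equal Ward-text copy — δ-unfold; Lines
modules are not importable, so the registered text itself cannot be named here), and the PROVED map
`CliqueWardCertGe q → NearCertWardSlackGe q`: an EXACT clique-sparse certificate is a near-certificate with `δ = 0` and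
weights `r_{k,i}² := tr (O_{k,i}ᴴ O_{k,i})` (`λ_max ≤ tr`, `posSemidef_trace_smul_one_sub_of_posSemidef`). So an lb-chord
exact certificate discharges THE REGISTERED STUB through one lemma — the file needs no registry slot of its own. The
converse (near ⇒ exact at the same value, slack absorbed into the blocks `Z k + δ_k • 1` plus a diagonal Gram block on
the SOS factors) is certificate-level `stub_slackAbsorb` (dual-plan-2's stub 2, O2 «provable now») and is NOT restated here. -/

section RecordMap

open WardText

/-- PARAMETRISED COPY of `FoDualRounding.NearCertWardSlack_m4o5` / `_m83o100` (Lines/fo_dual_rounding.lean §1, the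
skeletons of record; value literal replaced by `q`). -/
def NearCertWardSlackGe (q : ℝ) : Prop :=
  ∃ (Λ Λ' : Finset (Site 2)) (hΛ : Λ ⊆ Λ') (_h8 : thicken Λ 1 ⊆ Λ')
    (h0 : thicken ({0} : Finset (Site 2)) 1 ⊆ Λ') (hz : (0 : Site 2) ∈ Λ')
    (μ : ℝ)
    (nb : ℕ) (msz : Fin nb → ℕ) (Z : (k : Fin nb) → Matrix (Fin (msz k)) (Fin (msz k)) ℂ)
    (δs : Fin nb → ℝ) (_hδ : ∀ k, 0 ≤ δs k)
    (_hZ : ∀ k, (Z k + ((δs k : ℝ) : ℂ) • (1 : Matrix (Fin (msz k)) (Fin (msz k)) ℂ)).PosSemidef)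
    (O : (k : Fin nb) → Fin (msz k) → FermionOp Λ') (r : (k : Fin nb) → Fin (msz k) → ℝ)
    (_hO : ∀ k i, ((((r k i) ^ 2 : ℝ) : ℂ) • (1 : FermionOp Λ') - (O k i)ᴴ * O k i).PosSemidef)
    (ns : ℕ) (B : Fin ns → FermionOp Λ)
    (nt : ℕ) (γ : Fin nt → DihedralGroup 4) (wv : Fin nt → Site 2)
    (hsh : ∀ l, d4ShiftSet (γ l) (wv l) Λ ⊆ Λ') (Y : Fin nt → FermionOp Λ)
    (nu : ℕ) (b : Fin nu → ℂ) (cw : Fin nu → List (Orb (PolySite Λ') × Bool))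
    (_hcw : ∀ j ∈ (Finset.univ : Finset (Fin nu)), ladderCharge (cw j) ≠ 0 ∨ ladderSpinCharge (cw j) ≠ 0)
    (np : ℕ) (Xp : Fin np → FermionOp Λ') (nm' : ℕ) (Xm : Fin nm' → FermionOp Λ')
    (na : ℕ) (dc : Fin na → ℝ) (V : Fin na → FermionOp Λ')
    (nw : ℕ) (a : Fin nw → ℂ) (word : Fin nw → List (Orb (PolySite Λ') × Bool))
    (c : ℝ),
    WardD4Identity 1 0 8 (7 / 8) hΛ h0 hz μ (Matrix.blockDiagonal' Z)
      (fun p : (k : Fin nb) × Fin (msz k) => O p.1 p.2) Finset.univ B Finset.univ γ wv hsh Y Finset.univ b cw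
      Finset.univ Xp Finset.univ Xm Finset.univ dc V Finset.univ a word c ∧
    q ≤ c - ∑ k, ‖a k‖ - ∑ k, δs k * ∑ i, (r k i) ^ 2

/-- `FoDualRounding.NearCertWardSlack_m4o5` (statement of the registered stub `stub_nearCert_m4o5` on 21721). -/
def NearCertWardSlack_m4o5 : Prop := NearCertWardSlackGe (-4 / 5)

/-- `…LowerEdge_ge_m83o100…FoDualRounding.NearCertWardSlack_m83o100` (registered stub `stub_nearCert_m83o100` on 22024). -/
def NearCertWardSlack_m83o100 : Prop := NearCertWardSlackGe (-83 / 100)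

theorem nearCertWardSlackGe_mono {q q' : ℝ} (hle : q' ≤ q) (h : NearCertWardSlackGe q) :
    NearCertWardSlackGe q' := by
  obtain ⟨Λ, Λ', hΛ, h8, h0, hz, μ, nb, msz, Z, δs, hδ, hZ, O, r, hO, ns, B, nt, γ, wv, hsh, Y, nu, b, cw, hcw,
    np, Xp, nm', Xm, na, dc, V, nw, a, word, c, hcert, hq⟩ := h
  exact ⟨Λ, Λ', hΛ, h8, h0, hz, μ, nb, msz, Z, δs, hδ, hZ, O, r, hO, ns, B, nt, γ, wv, hsh, Y, nu, b, cw, hcw,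
    np, Xp, nm', Xm, na, dc, V, nw, a, word, c, hcert, hle.trans hq⟩

/-- **THE INSTANCE MAP (PROVED): an exact clique-sparse Ward × `D₄` certificate of value `q` is a near-certificate of
value `q`** — same blocks, `δ_k := 0`, weights `r_{k,i} := √(re tr (O_{k,i}ᴴ O_{k,i}))` with the SOS norm proof
`tr(OᴴO) • 1 − OᴴO ⪰ 0` (`λ_max ≤ tr` for `OᴴO ⪰ 0`). -/
theorem nearCertGe_of_cliqueWardCertGe (q : ℚ) (hC : CliqueWardCertGe q) : NearCertWardSlackGe (q : ℝ) := by
  obtain ⟨Λ, Λ', hΛ, h8, h0, hz, μ, nb, d, Λb, hΛb, O, ns, B, nt, γ, wv, hsh, Y, nu, b, cw, hcw, np, Xp, nm', Xm,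
    na, dc, V, nw, a, word, c, hcert, hq⟩ := hC
  refine ⟨Λ, Λ', hΛ, h8, h0, hz, μ, nb, d, Λb, fun _ => 0, fun _ => le_rfl, ?_, O,
    fun k i => Real.sqrt ((O k i)ᴴ * O k i).trace.re, ?_, ns, B, nt, γ, wv, hsh, Y, nu, b, cw, fun j _ => hcw j,
    np, Xp, nm', Xm, na, dc, V, nw, a, word, c, hcert, ?_⟩
  · intro k
    simpa using hΛb k
  · intro k i
    have hP : ((O k i)ᴴ * O k i).PosSemidef := Matrix.posSemidef_conjTranspose_mul_self _
    have htr : (0 : ℂ) ≤ ((O k i)ᴴ * O k i).trace := hP.trace_nonneg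
    obtain ⟨hre, him⟩ := Complex.nonneg_iff.mp htr
    have hceq : ((((Real.sqrt ((O k i)ᴴ * O k i).trace.re) ^ 2 : ℝ)) : ℂ) = ((O k i)ᴴ * O k i).trace := by
      rw [Real.sq_sqrt hre]
      exact Complex.ext (by simp) (by simpa using him)
    rw [hceq]
    exact Literature.MathematicalPhysics.QuantumChemistry.posSemidef_trace_smul_one_sub_of_posSemidef hP
  · simpa using hq

/-- A FACTORED (class C, PSD-free) certificate of value `q` is a registered near-certificate of value `q`
(`δ := 0`): the one-lemma path from a LOWRANK/SymCert-shaped literal to the registered value stub's statement. -/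
theorem nearCertGe_of_factorWardCertGe (q : ℚ) (hF : FactorWardCertGe q) : NearCertWardSlackGe (q : ℝ) :=
  nearCertGe_of_cliqueWardCertGe q (cliqueWardCertGe_of_factor q hF)

theorem nearCert_m4o5_of_cliqueWardEdition (hed : ∃ q : ℚ, (-4 / 5 : ℚ) ≤ q ∧ CliqueWardCertGe q) :
    NearCertWardSlack_m4o5 := by
  obtain ⟨q, hq, hC⟩ := hed
  exact nearCertWardSlackGe_mono (by exact_mod_cast hq) (nearCertGe_of_cliqueWardCertGe q hC)

theorem nearCert_m83o100_of_cliqueWardEdition (hed : ∃ q : ℚ, (-83 / 100 : ℚ) ≤ q ∧ CliqueWardCertGe q) :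
    NearCertWardSlack_m83o100 := by
  obtain ⟨q, hq, hC⟩ := hed
  exact nearCertWardSlackGe_mono (by exact_mod_cast hq) (nearCertGe_of_cliqueWardCertGe q hC)

end RecordMap

/-- Hypothesis form (sorry-free), class A (Ward-free lane, unconditional): an edition at −4/5 gives the crux's
statement (unfolded). -/
theorem lowerEdge_m4o5_of_edition (hed : ∃ q : ℚ, (-4 / 5 : ℚ) ≤ q ∧ CliqueCertBound q) :
    ∃ lo : ℚ, (-4 / 5 : ℚ) ≤ lo ∧ M3EnergyLowerRow 0 lo := by
  obtain ⟨q, hq, hC⟩ := hed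
  exact ⟨q, hq, m3Row_of_cliqueCertBound q hC⟩

/-- Hypothesis form (sorry-free), class A, sibling crux. -/
theorem lowerEdge_m83o100_of_edition (hed : ∃ q : ℚ, (-83 / 100 : ℚ) ≤ q ∧ CliqueCertBound q) :
    ∃ lo : ℚ, (-83 / 100 : ℚ) ≤ lo ∧ M3EnergyLowerRow 0 lo := by
  obtain ⟨q, hq, hC⟩ := hed
  exact ⟨q, hq, m3Row_of_cliqueCertBound q hC⟩

/-- THE SKELETON THEOREM for stmt-Ventures-21721: the crux `LowerEdge_ge_m4o5` BY NAME from the value stub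
`stub_cliqueWardEdition_m4o5` and the LANDED Ward theorem `Theorems.WardSlot.stub_wardWindowSound` (p612283). -/
theorem LowerEdge_ge_m4o5_of :
    Summit.Ventures.CertifiedManyBodySolver.Theses.M3PrimeEdgeSplit.LowerEdge_ge_m4o5 := by
  unfold Summit.Ventures.CertifiedManyBodySolver.Theses.M3PrimeEdgeSplit.LowerEdge_ge_m4o5
    Summit.Ventures.CertifiedManyBodySolver.MbsolverRungLeaves.M3Lower_tp0_ge_m4o5
  exact lowerEdge_m4o5_of_wardEdition stub_cliqueWardEdition_m4o5 stub_wardWindowSound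

/-- THE SKELETON THEOREM for stmt-Ventures-22024: the crux `LowerEdge_ge_m83o100` BY NAME from the value stub
`stub_cliqueWardEdition_m83o100` and the LANDED Ward theorem (p612283; rfl-equal to the −83/100 item's own copy p612562,
`wardWindowSound_textM83_eq`). -/
theorem LowerEdge_ge_m83o100_of :
    Summit.Ventures.CertifiedManyBodySolver.Theses.M3x2EdgeSplit.LowerEdge_ge_m83o100 := by
  unfold Summit.Ventures.CertifiedManyBodySolver.Theses.M3x2EdgeSplit.LowerEdge_ge_m83o100
  exact lowerEdge_m83o100_of_wardEdition stub_cliqueWardEdition_m83o100 stub_wardWindowSound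

end Summit.Ventures.CertifiedManyBodySolver.Cruxes.LowerEdge_ge_m4o5.CliqueSparseSos
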